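import Summits.QuantumFields.YangMills.Theorems.BalabanUVNodesK0RecordFormatNamesLemmas8
import Summits.QuantumFields.YangMills.Theorems.BalabanUVNodesPortS1Selector

/-!
# NODE O port PT-A — (f′) FROM A CONFIGURATION-LEVEL IDENTITY ON A SMALL-FIELD BALL AROUND `U = 1`: the form in which the expansions are printed
# ([16] (63) ∕ [II] (2.13): «for `U_{k+1}` in the small-field domain, `G(U_{k+1}) = Σ_X E(X, U_{k+1}|_X)`») transported to the residue's germ-at-`B = 0` row through the
# continuity of `B ↦ U_{k+1}(W_B)` at `0` (TokP9-reg shape) and `U_{k+1}(W_0) = 1`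

Cell `ym-nodeO-ideate`, porter seat `ymgap-nodeO-port-PTA-1` (gen 3); `--supports stmt-QuantumFields-27930` (helper).  [I] = [Balaban1987RG1], [II] = [Balaban1988RG2Cluster],
[16] = [Balaban1985UVStability3D].  Vocabulary: DEF-1 edition 13 ∕ lemma file 8 (`IntFormula.Represents`, `represents_iff`, `intCubes`, `pairCutAt`); gen 2's `…PortS1Selector` §3
(`continuousAt_recordBgField_of_analyticAt`, `recordBgField_zero`, `succ_le_m_add_K_recordK₀`).

WHY.  The suppliers of (f′) for `Φ₁ = log Z^{(k)}(U_{k+1}(W_B))` and `Φ₂ = 𝐄^{(k+1)}(g_k, U_{k+1}(W_B))` (S2A-SPEC-v1 §1) prove CONFIGURATION-LEVEL identities: for every fine field `U`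
with `‖U_b − 1‖ < δ` on all bonds, `G(U) = Σ_X Ψ(X̂)((U, J_ξ(U)) cut to X ∘ cover)` — print never mentions `B`.  The residue's row is a GERM identity in the chart variable `B`
at `0` for `G ∘ U_{k+1} ∘ W`.  This file is the passage, once: §1 under the TokP9-reg shape the rooted background field is eventually `δ`-close to `1` on every bond, for ANY
`δ > 0` (gen 2 proved `δ = ½`); §2 ★ `represents_of_cfgIdentity` — a configuration-level identity on a `δ`-ball (one `δ_n > 0` per volume) for functionals `Gcfg n` gives
`Ψ.Represents F a₀ ε₂₉ Mc k (fun n B => Gcfg n (U_{k+1}(W_B)))`; the (f′) integrand `pairCutAt` IS the cut pair of `(U_{k+1}(W_B), J(U_{k+1}(W_B)))` by `rfl`.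

HONEST FRAMING.  Plumbing; NO expansion of Bałaban's is constructed or asserted; the residue is NOT proved; 27930 OPEN; K0⁷ NOT closed; NODE O 0∕1; COUNT 8∕28 · K 1∕4 UNMOVED;
finite `𝕋⁴_{L^K}` at fixed ε — NOT continuum ∕ OS ∕ Clay; **the Yang–Mills mass gap is NOT proved by any of this.**  No `sorry`, no `def`, no `instance`; standard axioms.
-/

noncomputable section

open scoped BigOperators Matrix.Norms.L2Operator Topology

namespace Summit.QuantumFields.YangMills.Theorems.BalabanUVNodesPortS1

open Summit.QuantumFields.YangMills.Theorems.K0RecordFormatNames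
open Literature.MathematicalPhysics.QuantumFieldTheory.Balaban1983to89
open Literature.MathematicalPhysics.QuantumFieldTheory.Balaban1983to89.Node00
open Literature.MathematicalPhysics.QuantumFieldTheory.Balaban1983to89.T4Continuum (T4Family)
open Literature.MathematicalPhysics.QuantumFieldTheory.Balaban1983to89.B15Eq112TorusCover (cover)
open _root_.Filter

variable (F : T4Family)

/-! ## §1  Under the TokP9-reg shape: `U_{k+1}(W_B)` is eventually `δ`-close to `1` on every bond, for any `δ > 0` -/

/-- **Eventual `δ`-smallness of the rooted background field** (any `δ > 0`; `k + 1 ≤ m + K`): continuity at `0` (TokP9-reg shape) + `U_{k+1}(W_0) = 1` + finitely many bonds.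
[cite: Balaban1985Variational, Thm 1 p.279, Prop. 9 p.309; Balaban1987RG1, (2.3) p.265] -/
theorem eventually_norm_recordBgField_sub_one_lt (θ : Stage13Params F 2) {k K : ℕ} (hk : k + 1 ≤ (F.P K).m + (F.P K).K)
    (hP9 : letI := θ.instVβ₁; letI := θ.instVβ₂
      AnalyticAt ℝ (fun B : Fin (F.P K).d → Site (F.P K) (k + 1) → θ.Vβ => fun (b : PBond (F.P K) 0) (i i' : Fin 2) =>
        ((recordBgField F θ k K B b : SU 2) : Matrix (Fin 2) (Fin 2) ℂ) i i') 0)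
    {δ : ℝ} (hδ : 0 < δ) :
    letI := θ.instVβ₁; letI := θ.instVβ₂
    ∀ᶠ B in 𝓝 (0 : Fin (F.P K).d → Site (F.P K) (k + 1) → θ.Vβ),
      ∀ b : PBond (F.P K) 0, ‖((recordBgField F θ k K B b : SU 2) : MatA 2) - 1‖ < δ := by
  letI := θ.instVβ₁; letI := θ.instVβ₂
  refine Filter.eventually_all.mpr fun b => ?_
  have hc := continuousAt_recordBgField_of_analyticAt F θ k K hP9 b
  have h0 : ((recordBgField F θ k K (0 : Fin (F.P K).d → Site (F.P K) (k + 1) → θ.Vβ) b : SU 2) : MatA 2) = 1 := by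
    rw [recordBgField_zero F θ hk]
    show (((1 : SU 2)) : MatA 2) = 1
    simp
  have hev := (Metric.tendsto_nhds.mp hc) δ hδ
  filter_upwards [hev] with B hB
  rwa [dist_eq_norm, h0] at hB

/-- The same AT THE TEXTS' LETTERS (`θ := thetaFill F a₀ ε₂₉`, `K := recordK₀ F Mc k + n`, the TokP9-reg token's body at `(k, n, ε₂₉)`).
[cite: Balaban1985Variational, Prop. 9 p.309; Balaban1987RG1, (2.3) p.265 (bookkeeping)] -/
theorem eventually_norm_recordBgField_sub_one_lt_at (a₀ ε₂₉ : ℝ) (Mc k n : ℕ)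
    (hP9 : letI θ := thetaFill F a₀ ε₂₉; letI := θ.instVβ₁; letI := θ.instVβ₂; letI := θ.instιβ
      AnalyticAt ℝ (fun B : recordW F a₀ ε₂₉ k (recordK₀ F Mc k + n) => fun (b : PBond (F.P (recordK₀ F Mc k + n)) 0) (i i' : Fin 2) =>
        ((recordBgField F θ k (recordK₀ F Mc k + n) B b : SU 2) : Matrix (Fin 2) (Fin 2) ℂ) i i') 0)
    {δ : ℝ} (hδ : 0 < δ) :
    letI θ := thetaFill F a₀ ε₂₉; letI := θ.instVβ₁; letI := θ.instVβ₂; letI := θ.instιβ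
    ∀ᶠ B in 𝓝 (0 : recordW F a₀ ε₂₉ k (recordK₀ F Mc k + n)),
      ∀ b : PBond (F.P (recordK₀ F Mc k + n)) 0, ‖((recordBgField F θ k (recordK₀ F Mc k + n) B b : SU 2) : MatA 2) - 1‖ < δ :=
  eventually_norm_recordBgField_sub_one_lt F (thetaFill F a₀ ε₂₉) (succ_le_m_add_K_recordK₀ F Mc k n) hP9 hδ

/-! ## §2  ★ (f′) from a configuration-level identity on a small-field ball -/

open scoped Classical in
/-- **The (f′) integrand IS the cut pair of `(U_{k+1}(W_B), J_ξ(U_{k+1}(W_B)))` read at the fine field `U := recordBgField … B`** (`rfl`: `recordCurrent` is the (1.8) current of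
`recordBgUnits = ιSU ∘ recordBgField` at `ξ = η(k+1)`). [cite: Balaban1987RG1, (1.8)–(1.9) p.261 (bookkeeping)] -/
theorem pairCutAt_eq_cutPair_recordBgField (a₀ ε₂₉ : ℝ) (Mc k K : ℕ) (X : (recordDomSys F Mc k K).Dom) (B : recordW F a₀ ε₂₉ k K) :
    letI θ := thetaFill F a₀ ε₂₉; letI := θ.instVβ₁; letI := θ.instVβ₂; letI := θ.instιβ
    pairCutAt F a₀ ε₂₉ Mc k K X B =
      fun zμ =>
        ((if (⟨cover (F.P K) zμ.1, zμ.2⟩ : PBond (F.P K) 0) ∈ domBonds F Mc k K X then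
            ((recordBgField F θ k K B ⟨cover (F.P K) zμ.1, zμ.2⟩ : SU 2) : MatA 2) else 1),
         (if (⟨cover (F.P K) zμ.1, zμ.2⟩ : PBond (F.P K) 0) ∈ domBonds F Mc k K X then
            B12Eq18Current.current sl2Proj ((F.P K).eta (k + 1)) (fun b => ιSU 2 (recordBgField F θ k K B b)) ⟨cover (F.P K) zμ.1, zμ.2⟩ else 0)) :=
  rfl

open scoped Classical in
/-- ★ **(f′) FROM A CONFIGURATION-LEVEL IDENTITY ON A SMALL-FIELD BALL.**  Let `Gcfg n` be functionals of the FINE field at every volume `K₀ + n`, and suppose print's localized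
representation holds at configuration level: for some `δ_n > 0`, every `U` with `‖U_b − 1‖ < δ_n` on all bonds satisfies `Gcfg n U = Σ_X Ψ(X̂_K(X))((U, J_ξ(U)) cut to X ∘ cover)`.
Then, under the TokP9-reg shape at every volume, `Ψ` REPRESENTS the charted family `B ↦ Gcfg n (U_{k+1}(W_B))` in the residue's sense (germ at `B = 0`).
[cite: Balaban1987RG1, (1.6)–(1.9) p.261, (2.3) p.265; Balaban1985UVStability3D, (63) p.272; Balaban1988RG2Cluster, (2.13) p.14; Balaban1985Variational, Prop. 9 p.309] -/
theorem represents_of_cfgIdentity (a₀ ε₂₉ : ℝ) (Mc k : ℕ) (Ψ : IntFormula)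
    (Gcfg : (n : ℕ) → GaugeField (F.P (recordK₀ F Mc k + n)) 0 (SU 2) → ℂ)
    (hP9 : ∀ n, letI θ := thetaFill F a₀ ε₂₉; letI := θ.instVβ₁; letI := θ.instVβ₂; letI := θ.instιβ
      AnalyticAt ℝ (fun B : recordW F a₀ ε₂₉ k (recordK₀ F Mc k + n) => fun (b : PBond (F.P (recordK₀ F Mc k + n)) 0) (i i' : Fin 2) =>
        ((recordBgField F θ k (recordK₀ F Mc k + n) B b : SU 2) : Matrix (Fin 2) (Fin 2) ℂ) i i') 0)
    (hcfg : ∀ n, ∃ δ : ℝ, 0 < δ ∧ ∀ U : GaugeField (F.P (recordK₀ F Mc k + n)) 0 (SU 2),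
      (∀ b, ‖((U b : SU 2) : MatA 2) - 1‖ < δ) →
        Gcfg n U = ∑ X : (recordDomSys F Mc k (recordK₀ F Mc k + n)).Dom,
          Ψ (intCubes F Mc k (recordK₀ F Mc k + n) X)
            (fun zμ =>
              ((if (⟨cover (F.P (recordK₀ F Mc k + n)) zμ.1, zμ.2⟩ : PBond (F.P (recordK₀ F Mc k + n)) 0) ∈ domBonds F Mc k (recordK₀ F Mc k + n) X then
                  ((U ⟨cover (F.P (recordK₀ F Mc k + n)) zμ.1, zμ.2⟩ : SU 2) : MatA 2) else 1),
               (if (⟨cover (F.P (recordK₀ F Mc k + n)) zμ.1, zμ.2⟩ : PBond (F.P (recordK₀ F Mc k + n)) 0) ∈ domBonds F Mc k (recordK₀ F Mc k + n) X then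
                  B12Eq18Current.current sl2Proj ((F.P (recordK₀ F Mc k + n)).eta (k + 1)) (fun b => ιSU 2 (U b)) ⟨cover (F.P (recordK₀ F Mc k + n)) zμ.1, zμ.2⟩
                else 0)))) :
    Ψ.Represents F a₀ ε₂₉ Mc k
      (fun n B => letI θ := thetaFill F a₀ ε₂₉; letI := θ.instVβ₁; letI := θ.instVβ₂; letI := θ.instιβ
        Gcfg n (recordBgField F θ k (recordK₀ F Mc k + n) B)) := by
  rw [IntFormula.represents_iff]
  intro n
  letI θ := thetaFill F a₀ ε₂₉; letI := θ.instVβ₁; letI := θ.instVβ₂; letI := θ.instιβ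
  obtain ⟨δ, hδ, hid⟩ := hcfg n
  filter_upwards [eventually_norm_recordBgField_sub_one_lt_at F a₀ ε₂₉ Mc k n (hP9 n) hδ] with B hB
  exact hid _ hB

end Summit.QuantumFields.YangMills.Theorems.BalabanUVNodesPortS1

end
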